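import Mathlib
import Summits.NavierStokesRegularity.NavierStokesRegularity.Theorems.SqueezeCycleMustSqueezeSignedBudget
import Summits.NavierStokesRegularity.NavierStokesRegularity.Theorems.DssFarFieldSlavingBlowupTypeIDssProfileGaussianGapTypeI
import Literature.Analysis.FluidPDE.TaoEnstrophyLocalisationProofs
import HarnessLib

/-!
# Localised similarity enstrophy under the TIME-ONLY Type-I bound: the budget
  `Z_R' ≤ −½(1 − C²) Z_R + (L/R) ∫_{B̄_{2R}} ‖Ω‖²` (pub-ns-dss theory EXPLICIT-THRESHOLDS row T31⁗,
  file 1/2; route `DssFarFieldSlaving`, crux `BlowupTypeIDssProfile`, stmt-NavierStokesRegularity-0155 —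
  SUPPORT, label-free helper; typer seat g17, 2026-08-26)

HONEST FRAMING. Label-free analysis helper about a HYPOTHETICAL object (a Type-I ancient mild solution
in the Koch–Nadirashvili–Seregin–Šverák gauge, `IsTypeIAncientMild C V`: jointly smooth on `t < 0`,
divergence free, Oseen-mild between all pairs of negative times, `‖V(t,x)‖ ≤ C/√(−t)`), with NO
spatial decay hypothesis. Nothing numeric; no census words; nothing here bears on Navier–Stokes
regularity or blow-up. Consumer: file 2/2 (`…SimilarityEnstrophyTimeOnlyThreshold.lean`, T31⁗:
`C < 1 ⇒ V ≡ 0`).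

CONTENTS. With `U = lerayOrbit V`, `Ω = lerayVorticity V = curl U` (`‖U‖ ≤ C`) and the radial
ray-monotone cutoff `φ_R(y) = smoothTransition (2 − ‖y‖²/R²)` of `RadialSmoothCutoff`, the
localised enstrophy `Z_R(s) = ∫ φ_R ‖Ω(s)‖²` is exactly the one of crux `MustSqueeze` (route
SqueezeCycle), whose landed identity `signedBudget_deriv_cutoffEnstrophy_eq` (valid for every class
element) reads
`Z_R' = −½Z_R + ½∫(y·∇φ_R)‖Ω‖² + ∫(U·∇φ_R)‖Ω‖² + 2∫φ_R⟪DU Ω, Ω⟫ + ∫‖Ω‖²Δφ_R − 2∫φ_R‖∇Ω‖²_F`.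
Here: `le_div_of_deriv_le_neg_mul_add` (backward ODE bound `Z ≤ L/κ` for bounded `Z` with
`Z' ≤ −κZ + L` on `ℝ`), `integral_mul_inner_stretching_eq` (`∫φ⟪DU W, W⟫ = −∫φ⟪U, DW W⟫ − ∫Dφ(W)⟪U,W⟫`
for `div W = 0`, compact `φ`), the collar estimate `abs_integral_le_of_weight_sq`, the stretching
bound **`two_mul_integral_cutoff_stretching_le`** (`2∫φ⟪DU Ω,Ω⟫ ≤ 2∫φ‖∇Ω‖²_F + (C²/2)Z_R + 2C(c₁/R)∫_{B̄_{2R}}‖Ω‖²`,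
Young with `‖U‖ ≤ C` — the only place the threshold `1` comes from), and the budget
**`deriv_cutoffEnstrophy_le`**: `Z_R' ≤ −½(1 − C²)Z_R + (L/R)∫_{B̄_{2R}}‖Ω‖²` for `R ≥ 1`
(`L = 3Cc₁ + c₂` from `‖Dφ_R‖ ≤ c₁/R`, `|Δφ_R| ≤ c₂/R²`; the drift flux is `≤ 0`,
`signedBudget_drift_flux_nonpos`). [this file; folklore energy method; theory T31⁗ derivation
(cut-off similarity enstrophy)]
-/

noncomputable section

set_option linter.dupNamespace false

namespace Summit.NavierStokesRegularity.NavierStokesRegularity.Theorems.SimilarityEnstrophy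

open MeasureTheory Set Filter Topology Metric InnerProductSpace Function Real
open scoped RealInnerProductSpace Laplacian ContDiff
open Literature.Analysis Literature.Analysis.FluidPDE
open Summit.NavierStokesRegularity.NavierStokesRegularity.Theorems
open Summit.NavierStokesRegularity.NavierStokesRegularity.Theorems.GaussianGap

/-! ### The backward ODE bound -/

/-- **Backward (ancient) ODE bound.** A differentiable `Z : ℝ → ℝ`, bounded above, with
`Z' ≤ −κ Z + L` on `ℝ` for some `κ > 0`, satisfies `Z ≤ L/κ` everywhere: `(Z − L/κ)e^{κ s}` is
non-increasing and tends to `0` at `−∞`. [folklore] -/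
theorem le_div_of_deriv_le_neg_mul_add {Z : ℝ → ℝ} (hd : Differentiable ℝ Z)
    (hbdd : ∃ B, ∀ s, Z s ≤ B) {κ L : ℝ} (hκ : 0 < κ)
    (hZ' : ∀ s, deriv Z s ≤ -κ * Z s + L) : ∀ s, Z s ≤ L / κ := by
  obtain ⟨B, hB⟩ := hbdd
  set W : ℝ → ℝ := fun s => (Z s - L / κ) * Real.exp (κ * s) with hW
  have hWd : ∀ s, HasDerivAt W (deriv Z s * Real.exp (κ * s) +
      (Z s - L / κ) * (Real.exp (κ * s) * κ)) s := by
    intro s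
    have h1 : HasDerivAt (fun s => Real.exp (κ * s)) (Real.exp (κ * s) * κ) s := by
      have := ((hasDerivAt_id s).const_mul κ).exp
      simpa using this
    exact (((hd s).hasDerivAt).sub_const (L / κ)).mul h1
  have hW' : ∀ s, deriv W s ≤ 0 := by
    intro s
    rw [(hWd s).deriv]
    have hexp : 0 < Real.exp (κ * s) := Real.exp_pos _
    have h2 : deriv Z s + (Z s - L / κ) * κ ≤ 0 := by
      have : (Z s - L / κ) * κ = κ * Z s - L := by field_simp
      rw [this]; linarith [hZ' s]
    nlinarith
  have hanti : Antitone W := antitone_of_deriv_nonpos (fun s => (hWd s).differentiableAt) hW'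
  intro s
  -- `W s ≤ W s₀ ≤ max (B - L/κ) 0 · e^{κ s₀}` for `s₀ ≤ s`, and the right side tends to `0`
  have hle : ∀ s₀ ≤ s, W s ≤ max (B - L / κ) 0 * Real.exp (κ * s₀) := fun s₀ hs₀ =>
    (hanti hs₀).trans (mul_le_mul_of_nonneg_right ((sub_le_sub_right (hB s₀) _).trans
      (le_max_left _ _)) (Real.exp_pos _).le)
  have hlim : Tendsto (fun s₀ : ℝ => max (B - L / κ) 0 * Real.exp (κ * s₀)) atBot (𝓝 0) := by
    have h := Real.tendsto_exp_atBot.comp (tendsto_id.const_mul_atBot hκ)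
    simpa using h.const_mul (max (B - L / κ) 0)
  have hWle : W s ≤ 0 :=
    ge_of_tendsto hlim (eventually_atBot.2 ⟨s, fun s₀ hs₀ => hle s₀ hs₀⟩)
  have hexp : 0 < Real.exp (κ * s) := Real.exp_pos _
  have : Z s - L / κ ≤ 0 := by
    by_contra h
    have h' : 0 < Z s - L / κ := lt_of_not_ge h
    have : 0 < W s := mul_pos h' hexp
    linarith
  linarith

/-! ### Integration by parts for the stretching term against a cutoff -/

/-- **Moving the derivative off the stretched field, against a cutoff.** For `C¹` fields
`U, W : ℝ³ → ℝ³` with `div W = 0` and a compactly supported `C¹` weight `φ`,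
`∫ φ ⟪DU(W), W⟫ = −∫ φ ⟪U, DW(W)⟫ − ∫ Dφ(W) ⟪U, W⟫` (the trilinear convection identity
`integral_inner_convect_add_eq_zero` applied to `(W, U, φW)`). [folklore] -/
theorem integral_mul_inner_stretching_eq {φ : EuclideanSpace ℝ (Fin 3) → ℝ}
    {U W : EuclideanSpace ℝ (Fin 3) → EuclideanSpace ℝ (Fin 3)}
    (hφ : ContDiff ℝ 1 φ) (hφc : HasCompactSupport φ) (hU : ContDiff ℝ 1 U) (hW : ContDiff ℝ 1 W)
    (hdiv : VectorCalculus.IsDivFree W) :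
    ∫ y, φ y * ⟪fderiv ℝ U y (W y), W y⟫ =
      -(∫ y, φ y * ⟪U y, fderiv ℝ W y (W y)⟫) - ∫ y, fderiv ℝ φ y (W y) * ⟪U y, W y⟫ := by
  have hφW : ContDiff ℝ 1 fun z => φ z • W z := hφ.smul hW
  have hφWc : HasCompactSupport fun z => φ z • W z := hφc.smul_right
  have key := integral_inner_convect_add_eq_zero (u := W) (v := U) (w := fun z => φ z • W z) hW hU
    hφW hφWc
  have hdφ : ∀ y, DifferentiableAt ℝ φ y := fun y => hφ.differentiable one_ne_zero y
  have hdW : ∀ y, DifferentiableAt ℝ W y := fun y => hW.differentiable one_ne_zero y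
  have e1 : ∀ y, ⟪convect W U y, φ y • W y⟫ = φ y * ⟪fderiv ℝ U y (W y), W y⟫ := fun y => by
    rw [convect_apply, real_inner_smul_right]
  have e2 : ∀ y, ⟪U y, convect W (fun z => φ z • W z) y⟫ =
      fderiv ℝ φ y (W y) * ⟪U y, W y⟫ + φ y * ⟪U y, fderiv ℝ W y (W y)⟫ := fun y => by
    rw [convect_apply, fderiv_smul_apply_of_differentiableAt (hdφ y) (hdW y), inner_add_right,
      real_inner_smul_right, real_inner_smul_right]
  have e3 : ∀ y, VectorCalculus.divergence W y * ⟪U y, φ y • W y⟫ = 0 := fun y => by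
    rw [hdiv y, zero_mul]
  -- integrability of the two pieces of `e2`
  have hcW : Continuous W := hW.continuous
  have hcU : Continuous U := hU.continuous
  have hcDW : Continuous (fderiv ℝ W) := hW.continuous_fderiv one_ne_zero
  have hcφ : Continuous φ := hφ.continuous
  have hcDφ : Continuous (fderiv ℝ φ) := hφ.continuous_fderiv one_ne_zero
  have iA : Integrable fun y => fderiv ℝ φ y (W y) * ⟪U y, W y⟫ := by
    refine ((hcDφ.clm_apply hcW).mul (hcU.inner hcW)).integrable_of_hasCompactSupport ?_
    exact HasCompactSupport.intro hφc fun y hy => by simp [fderiv_of_notMem_tsupport ℝ hy]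
  have iB : Integrable fun y => φ y * ⟪U y, fderiv ℝ W y (W y)⟫ :=
    (hcφ.mul (hcU.inner (hcDW.clm_apply hcW))).integrable_of_hasCompactSupport hφc.mul_right
  have s1 : ∫ y, ⟪convect W U y, φ y • W y⟫ = ∫ y, φ y * ⟪fderiv ℝ U y (W y), W y⟫ :=
    integral_congr_ae (Eventually.of_forall e1)
  have s2 : ∫ y, ⟪U y, convect W (fun z => φ z • W z) y⟫ =
      (∫ y, fderiv ℝ φ y (W y) * ⟪U y, W y⟫) + ∫ y, φ y * ⟪U y, fderiv ℝ W y (W y)⟫ := by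
    rw [← integral_add iA iB]
    exact integral_congr_ae (Eventually.of_forall e2)
  have s3 : ∫ y, VectorCalculus.divergence W y * ⟪U y, φ y • W y⟫ = 0 := by
    rw [integral_congr_ae (Eventually.of_forall e3), integral_zero]
  rw [s1, s2, s3] at key
  linarith

/-! ### A collar estimate against `‖Ω‖²` -/

/-- **Collar estimate.** If `|g| ≤ w · ‖Ω‖²` pointwise with a continuous weight `w` vanishing off
`closedBall 0 ρ` and bounded by `m` there, and `Ω` is continuous, then
`|∫ g| ≤ m · ∫_{closedBall 0 ρ} ‖Ω‖²`. [folklore] -/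
theorem abs_integral_le_of_weight_sq {g w : EuclideanSpace ℝ (Fin 3) → ℝ}
    {Ω : EuclideanSpace ℝ (Fin 3) → EuclideanSpace ℝ (Fin 3)} (hΩ : Continuous Ω) {ρ m : ℝ}
    (hw : Continuous w) (hw0 : ∀ y ∉ closedBall (0 : EuclideanSpace ℝ (Fin 3)) ρ, w y = 0)
    (hwm : ∀ y ∈ closedBall (0 : EuclideanSpace ℝ (Fin 3)) ρ, w y ≤ m)
    (hg : ∀ y, |g y| ≤ w y * ‖Ω y‖ ^ 2) :
    |∫ y, g y| ≤ m * ∫ y in closedBall (0 : EuclideanSpace ℝ (Fin 3)) ρ, ‖Ω y‖ ^ 2 := by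
  set F : EuclideanSpace ℝ (Fin 3) → ℝ := fun y => ‖Ω y‖ ^ 2 with hF
  have hFc : Continuous F := hΩ.norm.pow 2
  have hF0 : ∀ y, 0 ≤ F y := fun y => sq_nonneg _
  have hG0 : ∀ y ∉ closedBall (0 : EuclideanSpace ℝ (Fin 3)) ρ, w y * F y = 0 := fun y hy => by
    rw [hw0 y hy, zero_mul]
  have hGi : Integrable fun y => w y * F y :=
    (hw.mul hFc).integrable_of_hasCompactSupport
      (HasCompactSupport.intro (isCompact_closedBall _ _) hG0)
  have h1 : |∫ y, g y| ≤ ∫ y, w y * F y := by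
    have := norm_integral_le_of_norm_le hGi (Eventually.of_forall fun y => by
      rw [Real.norm_eq_abs]; exact hg y)
    simpa only [Real.norm_eq_abs] using this
  have h2 : (∫ y, w y * F y) = ∫ y in closedBall (0 : EuclideanSpace ℝ (Fin 3)) ρ, w y * F y :=
    (setIntegral_eq_integral_of_forall_compl_eq_zero hG0).symm
  have hmi : IntegrableOn (fun y => m * F y) (closedBall (0 : EuclideanSpace ℝ (Fin 3)) ρ) :=
    ((continuous_const.mul hFc).continuousOn).integrableOn_compact (isCompact_closedBall _ _)
  have h3 : (∫ y in closedBall (0 : EuclideanSpace ℝ (Fin 3)) ρ, w y * F y) ≤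
      ∫ y in closedBall (0 : EuclideanSpace ℝ (Fin 3)) ρ, m * F y :=
    setIntegral_mono_on hGi.integrableOn hmi measurableSet_closedBall fun y hy =>
      mul_le_mul_of_nonneg_right (hwm y hy) (hF0 y)
  rw [integral_const_mul] at h3
  linarith


/-! ### The localised enstrophy budget from the time-only Type-I bound -/

section Budget

variable {C : ℝ} {V : ℝ → EuclideanSpace ℝ (Fin 3) → EuclideanSpace ℝ (Fin 3)}

/-- `y ↦ ‖∇Ω(s, y)‖²_F` is continuous. [folklore] -/
theorem continuous_frobeniusNormSq_fderiv_lerayVorticity (hV : IsTypeIAncientMild C V) (s : ℝ) :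
    Continuous fun y => frobeniusNormSq (fderiv ℝ (lerayVorticity V s) y) := by
  have hc : Continuous (fderiv ℝ (lerayVorticity V s)) :=
    (signedBudget_contDiff_lerayVorticity_slice hV s (n := 1)).continuous_fderiv one_ne_zero
  unfold frobeniusNormSq
  exact continuous_finsetSum _ fun i _ => ((hc.clm_apply continuous_const).norm).pow 2

/-- **The stretching term against the cutoff, bounded by the Type-I constant alone.** With
`‖U‖ ≤ C`: `2∫φ⟪DU Ω, Ω⟫ ≤ 2∫φ‖∇Ω‖²_F + (C²/2)∫φ‖Ω‖² + 2C‖∇φ‖_∞ ∫_{supp φ}‖Ω‖²` — move the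
derivative onto `Ω` (`div Ω = 0`), `|⟪U, DΩ Ω⟫| ≤ C‖DΩ‖_op‖Ω‖ ≤ ‖DΩ‖²_F + (C²/4)‖Ω‖²`, and the
collar term through `‖Dφ‖ ≤ c₁/R`. [this file; folklore] -/
theorem two_mul_integral_cutoff_stretching_le (hV : IsTypeIAncientMild C V) {c₁ : ℝ}
    (hc₁ : ∀ R : ℝ, 0 < R → ∀ y : EuclideanSpace ℝ (Fin 3),
      ‖fderiv ℝ (fun z : EuclideanSpace ℝ (Fin 3) => smoothTransition (2 - ‖z‖ ^ 2 / R ^ 2)) y‖ ≤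
        c₁ / R)
    {R : ℝ} (hR : 0 < R) (s : ℝ) :
    2 * (∫ y, smoothTransition (2 - ‖y‖ ^ 2 / R ^ 2) *
        ⟪fderiv ℝ (lerayOrbit V s) y (lerayVorticity V s y), lerayVorticity V s y⟫) ≤
      2 * (∫ y, smoothTransition (2 - ‖y‖ ^ 2 / R ^ 2) *
          frobeniusNormSq (fderiv ℝ (lerayVorticity V s) y)) +
        (C ^ 2 / 2) * (∫ y, smoothTransition (2 - ‖y‖ ^ 2 / R ^ 2) * ‖lerayVorticity V s y‖ ^ 2) +
        2 * C * (c₁ / R) *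
          ∫ y in closedBall (0 : EuclideanSpace ℝ (Fin 3)) (2 * R), ‖lerayVorticity V s y‖ ^ 2 := by
  have hC : 0 ≤ C := hV.nonneg
  set φ : EuclideanSpace ℝ (Fin 3) → ℝ := fun z => smoothTransition (2 - ‖z‖ ^ 2 / R ^ 2)
    with hφdef
  set Ω := lerayVorticity V s with hΩdef
  set U := lerayOrbit V s with hUdef
  have hφ1 : ContDiff ℝ 1 φ := contDiff_smoothTransition_cutoff (n := 1) R
  have hφc : HasCompactSupport φ := hasCompactSupport_smoothTransition_cutoff hR
  have hφ0 : ∀ y, 0 ≤ φ y := fun y => smoothTransition_cutoff_nonneg R y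
  have hΩ1 : ContDiff ℝ 1 Ω := signedBudget_contDiff_lerayVorticity_slice hV s (n := 1)
  have hU1 : ContDiff ℝ 1 U := mustSqueeze_contDiff_lerayOrbit_slice hV s (n := 1)
  have hUC : ∀ y, ‖U y‖ ≤ C := fun y => norm_lerayOrbit_le_of_typeI hV s y
  have hdivΩ : VectorCalculus.IsDivFree Ω := fun y =>
    divergence_curl_eq_zero_holds _
      ((contDiff_lerayOrbit_slice_of_typeI hV s (n := (⊤ : ℕ∞)) le_rfl).of_le (by norm_cast)) y
  -- continuity
  have hcΩ : Continuous Ω := hΩ1.continuous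
  have hcU : Continuous U := hU1.continuous
  have hcDΩ : Continuous (fderiv ℝ Ω) := hΩ1.continuous_fderiv one_ne_zero
  have hcφ : Continuous φ := hφ1.continuous
  have hcDφ : Continuous (fderiv ℝ φ) := hφ1.continuous_fderiv one_ne_zero
  have hcF : Continuous fun y => frobeniusNormSq (fderiv ℝ Ω y) :=
    continuous_frobeniusNormSq_fderiv_lerayVorticity hV s
  -- move the derivative onto `Ω`
  have hIBP := integral_mul_inner_stretching_eq hφ1 hφc hU1 hΩ1 hdivΩ
  -- (a) the main term: `−∫φ⟪U, DΩ Ω⟫ ≤ ∫φ frob + (C²/4)∫φ‖Ω‖²`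
  have iF : Integrable fun y => φ y * frobeniusNormSq (fderiv ℝ Ω y) :=
    (hcφ.mul hcF).integrable_of_hasCompactSupport hφc.mul_right
  have iZ : Integrable fun y => φ y * ‖Ω y‖ ^ 2 :=
    (hcφ.mul (hcΩ.norm.pow 2)).integrable_of_hasCompactSupport hφc.mul_right
  have iQ : Integrable fun y => φ y * ⟪U y, fderiv ℝ Ω y (Ω y)⟫ :=
    (hcφ.mul (hcU.inner (hcDΩ.clm_apply hcΩ))).integrable_of_hasCompactSupport hφc.mul_right
  have hmain : -(∫ y, φ y * ⟪U y, fderiv ℝ Ω y (Ω y)⟫) ≤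
      (∫ y, φ y * frobeniusNormSq (fderiv ℝ Ω y)) + (C ^ 2 / 4) * ∫ y, φ y * ‖Ω y‖ ^ 2 := by
    rw [← integral_neg, ← integral_const_mul, ← integral_add iF (iZ.const_mul _)]
    refine integral_mono iQ.neg (iF.add (iZ.const_mul _)) fun y => ?_
    dsimp only
    have hop := sq_opNorm_le_frobeniusNormSq (fderiv ℝ Ω y)
    set a := ‖fderiv ℝ Ω y‖ with ha
    set b := ‖Ω y‖ with hb
    have h1 : -(φ y * ⟪U y, fderiv ℝ Ω y (Ω y)⟫) ≤ φ y * (C * (a * b)) := by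
      rw [← mul_neg]
      refine mul_le_mul_of_nonneg_left ?_ (hφ0 y)
      calc -⟪U y, fderiv ℝ Ω y (Ω y)⟫ ≤ ‖⟪U y, fderiv ℝ Ω y (Ω y)⟫‖ := by
            rw [Real.norm_eq_abs]; exact neg_le_abs _
        _ ≤ ‖U y‖ * ‖fderiv ℝ Ω y (Ω y)‖ := norm_inner_le_norm _ _
        _ ≤ C * (a * b) :=
            mul_le_mul (hUC y) (ContinuousLinearMap.le_opNorm _ _) (norm_nonneg _) hC
    have h2 : C * (a * b) ≤ a ^ 2 + C ^ 2 / 4 * b ^ 2 := by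
      nlinarith [sq_nonneg (a - C * b / 2)]
    have h3 : φ y * (C * (a * b)) ≤ φ y * (frobeniusNormSq (fderiv ℝ Ω y) + C ^ 2 / 4 * b ^ 2) :=
      mul_le_mul_of_nonneg_left (h2.trans (by linarith)) (hφ0 y)
    linarith
  -- (b) the collar term
  have hcollar : |∫ y, fderiv ℝ φ y (Ω y) * ⟪U y, Ω y⟫| ≤
      C * (c₁ / R) * ∫ y in closedBall (0 : EuclideanSpace ℝ (Fin 3)) (2 * R), ‖Ω y‖ ^ 2 := by
    refine abs_integral_le_of_weight_sq hcΩ (w := fun y => C * ‖fderiv ℝ φ y‖)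
      (continuous_const.mul hcDφ.norm) (fun y hy => ?_) (fun y _ => ?_) (fun y => ?_)
    · show C * ‖fderiv ℝ φ y‖ = 0
      rw [hφdef, signedBudget_fderiv_cutoff_eq_zero hR hy, norm_zero, mul_zero]
    · show C * ‖fderiv ℝ φ y‖ ≤ C * (c₁ / R)
      exact mul_le_mul_of_nonneg_left (hc₁ R hR y) hC
    · rw [abs_mul]
      have e1 : |fderiv ℝ φ y (Ω y)| ≤ ‖fderiv ℝ φ y‖ * ‖Ω y‖ := by
        rw [← Real.norm_eq_abs]; exact ContinuousLinearMap.le_opNorm _ _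
      have e2 : |⟪U y, Ω y⟫| ≤ C * ‖Ω y‖ := by
        rw [← Real.norm_eq_abs]
        exact (norm_inner_le_norm _ _).trans (mul_le_mul_of_nonneg_right (hUC y) (norm_nonneg _))
      calc |fderiv ℝ φ y (Ω y)| * |⟪U y, Ω y⟫| ≤ (‖fderiv ℝ φ y‖ * ‖Ω y‖) * (C * ‖Ω y‖) :=
            mul_le_mul e1 e2 (abs_nonneg _) (by positivity)
        _ = C * ‖fderiv ℝ φ y‖ * ‖Ω y‖ ^ 2 := by ring
  have hcollar' : -(∫ y, fderiv ℝ φ y (Ω y) * ⟪U y, Ω y⟫) ≤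
      C * (c₁ / R) * ∫ y in closedBall (0 : EuclideanSpace ℝ (Fin 3)) (2 * R), ‖Ω y‖ ^ 2 :=
    (neg_le_abs _).trans hcollar
  rw [hIBP]
  linarith

/-- **The localised similarity-enstrophy inequality from the Type-I time bound alone.** For a
KNSS-gauge Type-I field `V` with constant `C` there is `L ≥ 0` such that for every `R ≥ 1` and every
`s`, the cut-off enstrophy `Z_R(s) = ∫ φ_R ‖Ω(s)‖²` (`φ_R(y) = smoothTransition (2 − ‖y‖²/R²)`)
satisfies `Z_R'(s) ≤ −½(1 − C²) Z_R(s) + (L/R) ∫_{B̄_{2R}} ‖Ω(s)‖²`: the tree's identity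
`signedBudget_deriv_cutoffEnstrophy_eq`, the signed drift flux (`signedBudget_drift_flux_nonpos`),
the stretching bound `two_mul_integral_cutoff_stretching_le`, and the collar bounds
`‖Dφ_R‖ ≤ c₁/R`, `|Δφ_R| ≤ c₂/R²` (`L = 3C c₁ + c₂`). [this file; folklore] -/
theorem deriv_cutoffEnstrophy_le (hV : IsTypeIAncientMild C V) :
    ∃ L : ℝ, 0 ≤ L ∧ ∀ R : ℝ, 1 ≤ R → ∀ s : ℝ,
      deriv (fun σ => ∫ y, smoothTransition (2 - ‖y‖ ^ 2 / R ^ 2) * ‖lerayVorticity V σ y‖ ^ 2) s ≤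
        -((1 / 2) * (1 - C ^ 2)) *
            (∫ y, smoothTransition (2 - ‖y‖ ^ 2 / R ^ 2) * ‖lerayVorticity V s y‖ ^ 2) +
          L / R * ∫ y in closedBall (0 : EuclideanSpace ℝ (Fin 3)) (2 * R),
            ‖lerayVorticity V s y‖ ^ 2 := by
  obtain ⟨c₁, hc₁0, hc₁⟩ :=
    exists_norm_fderiv_smoothTransition_cutoff_le (E := EuclideanSpace ℝ (Fin 3))
  obtain ⟨c₂, hc₂0, hc₂⟩ :=
    exists_abs_laplacian_smoothTransition_cutoff_le (E := EuclideanSpace ℝ (Fin 3))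
  have hC : 0 ≤ C := hV.nonneg
  refine ⟨3 * C * c₁ + c₂, by positivity, fun R hR1 s => ?_⟩
  have hR : 0 < R := lt_of_lt_of_le one_pos hR1
  rw [signedBudget_deriv_cutoffEnstrophy_eq hV hR s]
  set φ : EuclideanSpace ℝ (Fin 3) → ℝ := fun z => smoothTransition (2 - ‖z‖ ^ 2 / R ^ 2)
    with hφdef
  set Ω := lerayVorticity V s with hΩdef
  set U := lerayOrbit V s with hUdef
  set I : ℝ := ∫ y in closedBall (0 : EuclideanSpace ℝ (Fin 3)) (2 * R), ‖Ω y‖ ^ 2 with hIdef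
  have hI0 : 0 ≤ I := integral_nonneg fun y => sq_nonneg _
  have hφ1 : ContDiff ℝ 1 φ := contDiff_smoothTransition_cutoff (n := 1) R
  have hφ2 : ContDiff ℝ 2 φ := contDiff_smoothTransition_cutoff (n := 2) R
  have hcDφ : Continuous (fderiv ℝ φ) := hφ1.continuous_fderiv one_ne_zero
  have hΩ1 : ContDiff ℝ 1 Ω := signedBudget_contDiff_lerayVorticity_slice hV s (n := 1)
  have hcΩ : Continuous Ω := hΩ1.continuous
  have hUC : ∀ y, ‖U y‖ ≤ C := fun y => norm_lerayOrbit_le_of_typeI hV s y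
  -- (1) drift flux `≤ 0`
  have hD : (∫ y, fderiv ℝ φ y y * ‖Ω y‖ ^ 2) ≤ 0 := signedBudget_drift_flux_nonpos V R s
  -- (2) transport flux
  have hT : |∫ y, fderiv ℝ φ y (U y) * ‖Ω y‖ ^ 2| ≤ C * (c₁ / R) * I := by
    refine abs_integral_le_of_weight_sq hcΩ (w := fun y => C * ‖fderiv ℝ φ y‖)
      (continuous_const.mul hcDφ.norm) (fun y hy => ?_) (fun y _ => ?_) (fun y => ?_)
    · show C * ‖fderiv ℝ φ y‖ = 0
      rw [hφdef, signedBudget_fderiv_cutoff_eq_zero hR hy, norm_zero, mul_zero]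
    · show C * ‖fderiv ℝ φ y‖ ≤ C * (c₁ / R)
      exact mul_le_mul_of_nonneg_left (hc₁ R hR y) hC
    · rw [abs_mul, abs_of_nonneg (sq_nonneg ‖Ω y‖)]
      have e1 : |fderiv ℝ φ y (U y)| ≤ ‖fderiv ℝ φ y‖ * C := by
        rw [← Real.norm_eq_abs]
        exact (ContinuousLinearMap.le_opNorm _ _).trans
          (mul_le_mul_of_nonneg_left (hUC y) (norm_nonneg _))
      calc |fderiv ℝ φ y (U y)| * ‖Ω y‖ ^ 2 ≤ (‖fderiv ℝ φ y‖ * C) * ‖Ω y‖ ^ 2 :=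
            mul_le_mul_of_nonneg_right e1 (sq_nonneg _)
        _ = C * ‖fderiv ℝ φ y‖ * ‖Ω y‖ ^ 2 := by ring
  -- (3) viscous flux
  have hVisc : |∫ y, ‖Ω y‖ ^ 2 * (Δ φ) y| ≤ (c₂ / R ^ 2) * I := by
    refine abs_integral_le_of_weight_sq hcΩ (w := fun y => |(Δ φ) y|)
      (continuous_laplacian hφ2).abs (fun y hy => ?_) (fun y _ => hc₂ R hR y) (fun y => ?_)
    · show |(Δ φ) y| = 0
      rw [hφdef, signedBudget_laplacian_cutoff_eq_zero hR hy, abs_zero]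
    · rw [abs_mul, abs_of_nonneg (sq_nonneg ‖Ω y‖), mul_comm]
  have hR2 : c₂ / R ^ 2 ≤ c₂ / R := by
    rw [div_le_div_iff₀ (by positivity) hR]
    have : R ≤ R ^ 2 := by nlinarith
    exact mul_le_mul_of_nonneg_left this hc₂0
  -- (4) stretching
  have hS := two_mul_integral_cutoff_stretching_le hV hc₁ hR s
  -- assemble
  have hT' := (le_abs_self _).trans hT
  have hVisc' := ((le_abs_self _).trans hVisc).trans (mul_le_mul_of_nonneg_right hR2 hI0)
  have e : (3 * C * c₁ + c₂) / R * I = C * (c₁ / R) * I + 2 * C * (c₁ / R) * I + c₂ / R * I := by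
    ring
  rw [e]
  nlinarith [hD, hT', hVisc', hS]

end Budget

end Summit.NavierStokesRegularity.NavierStokesRegularity.Theorems.SimilarityEnstrophy

end
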